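import Literature.AlgebraicGeometry.Motives.HodgeLieWeightOneSl2Triple
import HarnessLib

/-!
# Weight-one Hodge structures with Hodge group of rank four, not of CM type. A: block calculus for the projector `P`
# and `F E ≠ 0`, `[E, F] ≠ 0`

Family `hodge`, layer `Literature/AlgebraicGeometry/Motives`; THEOREMS ONLY (no definition, no named fact; D-0026).
First file of the abstract heart of the cell `pub-hodgecm2` (COR-CM) lane MT-RANK-FIVE (the rung `dim Hg = 4` / `dim MT ≤ 5`
of the Mumford–Tate rank ladder for complex abelian varieties NOT of CM type); sequel of
`Motives/HodgeLieWeightOne{Projector,Sl2Triple,RankThree}` (rank `3`).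

SETTING (all files of the series).  `H` a pure `ℚ`-Hodge structure of weight `n = 1` on a finite-dimensional `V`, `e` a
graded basis adapted to `H` with degrees in `{0,1}`, `P = gradingEnd e deg` the projector onto `V^{1,0}` (`P² = P`),
`𝔥 = H.hodgeLie = Lie Hg(H)`, `𝔥_ℂ = H.hodgeLieC`, `X ∈ 𝔥 ∖ End_Hdg(V)` rational, `E = P X_ℂ (1 − P)`, `F = (1 − P) X_ℂ P`
(both in `𝔥_ℂ`, non-zero, exchanged by complex conjugation), `ψ` a polarization.

* `ProjectorBlocks.*` — identities in a ring with an idempotent `P` for elements of the four block types: `2P − 1`,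
  upper (`P E = E`, `E P = 0`), lower (`P F = 0`, `F P = F`), diagonal (`D P = P D`): the `(±)`-blocks `P T (1 − P)`,
  `(1 − P) T P`, the corners of `[E, F]`, `[2P − 1, E] = 2E`, `[2P − 1, F] = −2F`, `(2P − 1)² = 1` (the relations of an
  `𝔰𝔩₂`-triple `(2P − 1, E, F)` in a representation, Fulton–Harris Lecture 11).  Public because the sequel files reuse them.
* `projF_mul_projE_ne_zero` — **`F E ≠ 0`** with NO hypothesis on `dim 𝔥` (second Hodge–Riemann relation, as in the
  rank-`3` file where it gave `α ≠ 0`); `commutator_projE_projF_ne_zero` — **`[E, F] ≠ 0`** (its `(1 − P)`-corner is `−F E`).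

## References

* [MoonenZarhin1999LowDim] B. Moonen, Yu. Zarhin, *Hodge classes on abelian varieties of low dimension*, Math. Ann. 315
  (1999), §2 (Hodge group, `Hg ⊆ Sp(ψ)`, reductivity).
* [FultonHarris1991] W. Fulton, J. Harris, *Representation Theory*, GTM 129 (1991), Lecture 11 (§11.1).
* [Huybrechts2016K3] D. Huybrechts, *Lectures on K3 Surfaces* (2016), §3.3.4, Thm. 3.3.9 (proof, p. 67).
* [DeligneHodgeII1971] P. Deligne, *Théorie de Hodge II*, Publ. IHÉS 40 (1971), 2.1.4 (real structure, conjugation).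
-/

noncomputable section

open scoped TensorProduct

namespace Literature.AlgebraicGeometry.Motives

universe u

/-! ## §0 Block identities for an idempotent `P` (the relations of an `𝔰𝔩₂`-triple in a representation) -/

namespace ProjectorBlocks

variable {R : Type*} [Ring R] {P E F D : R}

/-- The blocks `P E (1 − P) = E`, `(1 − P) E P = 0` of an element with `P E = E`, `E P = 0`. [cite: FultonHarris1991, Lecture 11 (§11.1)] -/
theorem blocks_E (hPE : P * E = E) (hEP : E * P = 0) : P * E * (1 - P) = E ∧ (1 - P) * E * P = 0 := by
  constructor
  · rw [hPE, mul_sub, mul_one, hEP, sub_zero]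
  · rw [mul_assoc, hEP, mul_zero]

/-- The blocks `P F (1 − P) = 0`, `(1 − P) F P = F` of an element with `P F = 0`, `F P = F`. [cite: FultonHarris1991, Lecture 11 (§11.1)] -/
theorem blocks_F (hPF : P * F = 0) (hFP : F * P = F) : P * F * (1 - P) = 0 ∧ (1 - P) * F * P = F := by
  constructor
  · rw [hPF, zero_mul]
  · rw [mul_assoc, hFP, sub_mul, one_mul, hPF, sub_zero]

/-- The off-diagonal blocks of an element commuting with the idempotent `P` vanish. [cite: FultonHarris1991, Lecture 11 (§11.1)] -/
theorem blocks_D (hPP : P * P = P) (hDP : D * P = P * D) : P * D * (1 - P) = 0 ∧ (1 - P) * D * P = 0 := by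
  constructor
  · rw [← hDP, mul_assoc, mul_sub, mul_one, hPP, sub_self, mul_zero]
  · rw [mul_assoc, hDP, ← mul_assoc, sub_mul, one_mul, hPP, sub_self, zero_mul]

/-- `P [E, F] P = E F` and `(1 − P) [E, F] (1 − P) = −F E`. [cite: FultonHarris1991, Lecture 11 (§11.1)] -/
theorem corners_comm (hPE : P * E = E) (hEP : E * P = 0) (hPF : P * F = 0) (hFP : F * P = F) :
    P * (E * F - F * E) * P = E * F ∧ (1 - P) * (E * F - F * E) * (1 - P) = -(F * E) := by
  have hQE : (1 - P) * E = 0 := by rw [sub_mul, one_mul, hPE, sub_self]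
  have hEQ : E * (1 - P) = E := by rw [mul_sub, mul_one, hEP, sub_zero]
  have hQF : (1 - P) * F = F := by rw [sub_mul, one_mul, hPF, sub_zero]
  constructor
  · rw [mul_sub P (E * F) (F * E), sub_mul (P * (E * F)) (P * (F * E)) P, ← mul_assoc P E F, hPE, mul_assoc E F P, hFP,
      ← mul_assoc P F E, hPF, zero_mul, zero_mul, sub_zero]
  · rw [mul_sub (1 - P) (E * F) (F * E), sub_mul ((1 - P) * (E * F)) ((1 - P) * (F * E)) (1 - P), ← mul_assoc (1 - P) E F,
      hQE, zero_mul, zero_mul, zero_sub, ← mul_assoc (1 - P) F E, hQF, mul_assoc F E (1 - P), hEQ]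

variable [Algebra ℂ R]

/-- `P (2P − 1) = P = (2P − 1) P` for an idempotent `P`. [cite: FultonHarris1991, Lecture 11 (§11.1)] -/
theorem mul_theta (hPP : P * P = P) :
    P * ((2 : ℂ) • P - 1) = P ∧ ((2 : ℂ) • P - 1) * P = P := by
  constructor
  · rw [mul_sub, mul_smul_comm, hPP, mul_one, two_smul, add_sub_cancel_right]
  · rw [sub_mul, smul_mul_assoc, hPP, one_mul, two_smul, add_sub_cancel_right]

/-- The off-diagonal blocks of `2P − 1` vanish. [cite: FultonHarris1991, Lecture 11 (§11.1)] -/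
theorem blocks_theta (hPP : P * P = P) :
    P * ((2 : ℂ) • P - 1) * (1 - P) = 0 ∧ (1 - P) * ((2 : ℂ) • P - 1) * P = 0 := by
  constructor
  · rw [(mul_theta hPP).1, mul_sub, mul_one, hPP, sub_self]
  · rw [mul_assoc, (mul_theta hPP).2, sub_mul, one_mul, hPP, sub_self]

/-- `(2P − 1)² = 1`. [cite: FultonHarris1991, Lecture 11 (§11.1)] -/
theorem theta_mul_theta (hPP : P * P = P) : ((2 : ℂ) • P - 1) * ((2 : ℂ) • P - 1) = 1 := by
  rw [sub_mul, one_mul, smul_mul_assoc, (mul_theta hPP).1, sub_sub_cancel]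

/-- `(2P − 1) E − E (2P − 1) = 2 E` and `(2P − 1) F − F (2P − 1) = −2 F`. [cite: FultonHarris1991, Lecture 11 (§11.1)] -/
theorem theta_bracket (hPE : P * E = E) (hEP : E * P = 0) (hPF : P * F = 0) (hFP : F * P = F) :
    ((2 : ℂ) • P - 1) * E - E * ((2 : ℂ) • P - 1) = (2 : ℂ) • E ∧
      ((2 : ℂ) • P - 1) * F - F * ((2 : ℂ) • P - 1) = -((2 : ℂ) • F) := by
  constructor
  · rw [sub_mul, smul_mul_assoc, hPE, one_mul, mul_sub, mul_smul_comm, hEP, smul_zero, mul_one, zero_sub,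
      sub_neg_eq_add, sub_add_cancel]
  · rw [sub_mul, smul_mul_assoc, hPF, smul_zero, one_mul, zero_sub, mul_sub, mul_smul_comm, hFP, mul_one,
      two_smul, add_sub_cancel_right, neg_add']

end ProjectorBlocks

namespace HodgeStructure

open ProjectorBlocks

variable {V : Type u} [AddCommGroup V] [Module ℚ V] [Module.Finite ℚ V] [HodgeTensorFacts.{u, u}] {n : ℤ}
  {S : Type u} [Fintype S] [DecidableEq S] {deg : S → ℤ}

/-! ## §1 `F E ≠ 0` and `[E, F] ≠ 0` -/

/-- **`F E ≠ 0`** for the blocks `E = P X_ℂ (1 − P)`, `F = (1 − P) X_ℂ P` of a rational `X ∈ 𝔥 ∖ End_Hdg(V)` (weight `1`,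
degrees in `{0,1}`, `ψ` a polarization; no hypothesis on `dim 𝔥`): were `F E = 0`, for `u = F v ≠ 0` in `V^{0,1}` one gets
`ψ_ℂ(u, ū) = ψ_ℂ(F v, E v̄) = −ψ_ℂ(v, F E v̄) = 0` (`F ∈ 𝔥_ℂ` is `ψ_ℂ`-skew, `conj` exchanges the blocks), against the second
Hodge–Riemann relation. [cite: MoonenZarhin1999LowDim, §2] [cite: Huybrechts2016K3, Thm. 3.3.9 (proof, p. 67)] -/
theorem projF_mul_projE_ne_zero (H : HodgeStructure V n) (ψ : H.Polarization) (hn : n = 1)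
    (e : Module.Basis S ℂ (ℂ ⊗[ℚ] V)) (hF : ∀ a, H.F a = Submodule.span ℂ (e '' {σ | a ≤ deg σ}))
    (hFc : ∀ a, complexConj (H.F a) = Submodule.span ℂ (e '' {σ | deg σ ≤ n - a}))
    (hdeg : ∀ σ, deg σ = 0 ∨ deg σ = 1) {X : Module.End ℚ V} (hX : X ∈ H.hodgeLie) (hXE : X ∉ H.endAlg) :
    ((1 - gradingEnd e deg) * X.baseChange ℂ * gradingEnd e deg) *
      (gradingEnd e deg * X.baseChange ℂ * (1 - gradingEnd e deg)) ≠ 0 := by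
  classical
  set P := gradingEnd e deg with hP
  set Y := X.baseChange ℂ with hY
  set E := P * Y * (1 - P) with hEdef
  set F := (1 - P) * Y * P with hFdef
  intro hFE
  obtain ⟨-, hF0⟩ := projE_ne_zero_of_not_mem_endAlg H hn e hF hFc hdeg hXE
  rw [← hP, ← hY, ← hFdef] at hF0
  have hYM : Y ∈ H.hodgeLieC := H.baseChange_mem_hodgeLieC hX
  obtain ⟨-, hFM⟩ := projE_mem_hodgeLieC H e hF hFc hdeg hYM
  rw [← hP, ← hFdef] at hFM
  obtain ⟨v, hv⟩ : ∃ v, F v ≠ 0 := by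
    by_contra h
    push Not at h
    exact hF0 (LinearMap.ext fun v => by rw [h v, LinearMap.zero_apply])
  subst hn
  have hmem : F v ∈ H.piece 0 ((1 : ℤ) - 0) := by
    rw [piece_eq_span_of_graded H e hF hFc 0, hFdef, Module.End.mul_apply, Module.End.mul_apply]
    exact one_sub_gradingEnd_apply_mem_span_zero e hdeg _
  obtain ⟨r, hr, hre⟩ := ψ.pos 0 ((1 : ℤ) - 0) (by ring) (F v) hmem hv
  have hconj : conj (F v) = E (conj v) := by
    have h := conj_projF_conj_apply H rfl e hF hFc X (conj v)
    rw [conj_conj] at h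
    exact h
  have hzero : ψ.form.baseChange ℂ (F v) (conj (F v)) = 0 := by
    rw [hconj, formBaseChange_skew_of_mem_hodgeLieC ψ hFM v (E (conj v)), ← Module.End.mul_apply, hFE,
      LinearMap.zero_apply, map_zero, neg_zero]
  rw [hzero, mul_zero] at hre
  have hr0 : (r : ℂ) = 0 := hre.symm
  exact hr.ne' (by exact_mod_cast hr0)

/-- **`[E, F] ≠ 0`**: its `(1 − P)`-corner is `−F E ≠ 0`. [cite: MoonenZarhin1999LowDim, §2] -/
theorem commutator_projE_projF_ne_zero (H : HodgeStructure V n) (ψ : H.Polarization) (hn : n = 1)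
    (e : Module.Basis S ℂ (ℂ ⊗[ℚ] V)) (hF : ∀ a, H.F a = Submodule.span ℂ (e '' {σ | a ≤ deg σ}))
    (hFc : ∀ a, complexConj (H.F a) = Submodule.span ℂ (e '' {σ | deg σ ≤ n - a}))
    (hdeg : ∀ σ, deg σ = 0 ∨ deg σ = 1) {X : Module.End ℚ V} (hX : X ∈ H.hodgeLie) (hXE : X ∉ H.endAlg) :
    (gradingEnd e deg * X.baseChange ℂ * (1 - gradingEnd e deg)) *
        ((1 - gradingEnd e deg) * X.baseChange ℂ * gradingEnd e deg) -
      ((1 - gradingEnd e deg) * X.baseChange ℂ * gradingEnd e deg) *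
        (gradingEnd e deg * X.baseChange ℂ * (1 - gradingEnd e deg)) ≠ 0 := by
  classical
  intro h
  apply projF_mul_projE_ne_zero H ψ hn e hF hFc hdeg hX hXE
  set P := gradingEnd e deg with hP
  set Y := X.baseChange ℂ with hY
  have hPP : P * P = P := gradingEnd_mul_gradingEnd_of_deg e hdeg
  have hPE : P * (P * Y * (1 - P)) = P * Y * (1 - P) := by rw [← mul_assoc, ← mul_assoc, hPP]
  have hEP : P * Y * (1 - P) * P = 0 := by
    rw [mul_assoc (P * Y) (1 - P) P, sub_mul, one_mul, hPP, sub_self, mul_zero]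
  have hPF : P * ((1 - P) * Y * P) = 0 := by
    rw [mul_assoc (1 - P) Y P, ← mul_assoc P (1 - P) (Y * P), mul_sub, mul_one, hPP, sub_self, zero_mul]
  have hFP : (1 - P) * Y * P * P = (1 - P) * Y * P := by rw [mul_assoc ((1 - P) * Y) P P, hPP]
  have hc := (corners_comm hPE hEP hPF hFP).2
  rw [h, mul_zero, zero_mul] at hc
  exact neg_eq_zero.1 hc.symm

end HodgeStructure

end Literature.AlgebraicGeometry.Motives

end
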